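import Literature.MathematicalPhysics.QuantumLattice.SymmetricRegimeCertificate
import HarnessLib

/-!
# The symmetric-regime certificate with a FIELD RADIUS on the remainder (v2, `R`)

Topic `Literature/MathematicalPhysics/QuantumLattice`; definition request
`defn-symmetricRegimeCertificateR` (D1′b-v2 of route HubbardSuperconductivity/AposterioriCapRg, the
route-repair of stmt-13959, 2026-08-16; it types the producer crux `CapRgSymmetricCertificatePinned`
= stmt-14026 and the hypothesis of `SeededBrokenRegimeBoseFermiPinned` = stmt-14042).  A v2 UNDER A
NEW NAME of the pair `SymmetricRegimeFunctionals.lean` / `SymmetricRegimeCertificate.lean` (v1,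
p71321 / p71475), which are imported and left untouched; every v1 functional (`vertexSupNorm`,
`selfEnergy`, `omega0`, `momentumShell`, `fieldStrengthSpin`, `remainderWeightNorm`, `cooperMatrix`,
`CooperDominance`, `pairingStrength`, `stonerCharge`/`stonerSpin`, `ShellGeometry`, `renormalisedBandC`,
the window and margin constants) is REUSED unchanged.

## Why a v2 (the flag of v1, ll. 113–127 of `SymmetricRegimeFunctionals.lean`, and refuters
rattack-13959 F1/F1′, rattack-13960 M1)

In v1 the accuracy record `Θ = (η₁, c₀, w)` carries a bound `ρ_Λ ≤ η₁` on the weighted remainder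
norm `ρ_Λ = Σ_{m ∉ {0,2,4}} Λ^{(m-4)/2} ‖𝒱_m‖_∞` taken at UNIT field radius, and the rational enclosure
`∃ a b` of `λ_d` sits INSIDE the `L/β/M` block.  At unit radius already the tree-level terms
`Λ^{(m-4)/2}‖𝒱_m‖_∞ ≈ ½(2U)^{m/2-1}` are geometric in `m` (v1's own flag), so no accuracy may sit on
`ρ`, and a bound on it is information-free.  The constructive form of such a hypothesis carries a
FIELD RADIUS `h` among the physical data: Salmhofer's norms weigh the `m`-legged kernel by `h^m`
(Salmhofer 1998, §4.1–4.2, Thm. 1: `‖G̃_{mr}(t)‖ ≤ γ_{mr} e^{t(m/2-2)}` and the `h`-weighted sums of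
§5.3), and at radius `h_r` the relevant sum is `Σ_{m∉{0,2,4}} h_r^{m-4} Λ^{(m-4)/2} ‖𝒱_m‖_∞`, which in
the v1 vocabulary IS the v1 functional at the rescaled argument, `remainderWeightNorm L M β (h_r² Λ) G`
(`remainderWeightNorm_radius` below: `(h²Λ)^{(m-4)/2} = h^{m-4} Λ^{(m-4)/2}`).  Accordingly:

* `SymmetricRegimeDataR extends SymmetricRegimeData` — the physical data `π` gain the frame decay
  exponent `r` (`frameDecay`, v1 fixed `r = 6`), the remainder bound `E₃ > 0`, the field radius
  `0 < h_r ≤ 1` and the slope allowance `c₁ ≥ 0` of the mismatch clause;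
* `SymmetricTolerance` — `Θ = (c₀, w)`: mismatch constant and enclosure width, NO remainder entry;
* `SymmetricCertifiedAtR π Θ a b Λ L M β e G Z` — (0a) `Z ≠ 0`; (0b′) pointwise on the shell
  `|Re Σ((ω₀,k⃗),σ)| ≤ c₀ Λ + c₁ |e(k⃗)|`; (0c) `z(k⃗,σ) ∈ [ζ, 1/ζ]` on the shell; (i′a) `‖𝒱₄‖_∞ ≤ E₁`;
  (i′b) `remainderWeightNorm L M β (h_r² Λ) G ≤ E₃`; (ii′) Cooper dominance and the Stoner products
  `≤ 1 - σ` at every transfer; (iii′) `a ≤ λ_d ≤ b` for the GIVEN rationals `a, b`;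
* `SymmetricRegimeHoldsR π Θ n eC Λ L₀ e G Z` — frame admissible, `Λ ∈ [Λ₁,Λ₂]`, shell geometry, and
  `∃ a b : ℚ, 1/8 ≤ a ≤ b ≤ 1/5 ∧ b - a ≤ w ∧ ∀ L ≥ L₀ ∃ β₀ ∀ β ≥ β₀ ∃ M₀ ∀ M ≥ M₀, SymmetricCertifiedAtR … a b …`
  — the enclosure OUTSIDE the block (one window for the whole family);
* `symmetricRegimeCertificateR U μ π Θ K Λ L₀` — the model binding over the countertermed frame
  (`hubbardEffectiveActionCT … U μ 0 K Λ`, `hubbardEffPartitionFnCT`, `nambuXiCT`, `renormalisedBandC`,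
  `K.coeffNorm π.frameDecay`), exactly as v1's `symmetricRegimeCertificate`;
* `capRgCornerData : SymmetricRegimeDataR` — the route's LITERAL record `π₀` (frameBound `10`,
  frameDecay `4`, quarticBound `4`, remainderBound `32`, fieldRadius `1/4`, slopeAllowance `1/2`,
  stonerMargin `1/4`, fieldFloor `1/2`, velLower `1/2`, velUpper `4`, curvLower `1/25`, curvUpper `3`,
  vanHoveDist `1/2`, scaleLower `1/100`, scaleUpper `3/10`; rationale of the numerals: planner evidence
  REPAIR_13959.md §1–2, `h_r = 1/4` giving the tree ratio `6h_r² = 0.375`), ONE named constant for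
  producer and consumer.

## API (all proved)

Unfoldings `symmetricCertifiedAtR_iff`, `symmetricRegimeHoldsR_iff`, `symmetricRegimeCertificateR_iff`;
projections (`.ne_zero`, `.quartic_le`, `.remainder_le`, `.cooperDominance`, `.window`, `.coeffNorm_le`,
`.admitsScale`, `.scale_pos`, `.shellGeometry`); monotonicity in `L₀` (`.mono`);
`remainderWeightNorm_radius` (the `Σ h^{m-4} Λ^{(m-4)/2} ‖𝒱_m‖_∞` form); the junk tests
`not_symmetricCertifiedAtR_zero` (the zero action is never certified once `a > 0`) and
`not_symmetricRegimeCertificateR_free` (`U = 0`, `K = 0` ⇒ FALSE: the free effective action vanishes,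
`hubbardEffectiveActionCT_free_zero_frame`, so `λ_d = 0 < 1/8 ≤ a`); `capRgCornerData` field values by
`rfl`.

## NOT claimed

No instance of any predicate (that is crux stmt-14026); nothing about any model beyond the `U = 0`
junk test; v1 is not edited.  The records and predicates are posited by the route (a-posteriori
format, Figueras–Haro–Luque 2016 Thm. 2.5), like v1 and `HubbardScaleData`.

## Sources

M. Salmhofer, Commun. Math. Phys. 194 (1998) 249, §4.1–4.2 Thm. 1 (scale- and `h`-weighted norms of
the kernels), §5.3 [`Salmhofer1998`]; J. Feldman, M. Salmhofer, E. Trubowitz, J. Stat. Phys. 84 (1996)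
1209 (the counterterm frame, "keeping the Fermi surface fixed") [`FeldmanSalmhoferTrubowitz1996`];
J.-Ll. Figueras, A. Haro, A. Luque, Found. Comput. Math. 17 (2017) 1123, Thm. 2.5 (a-posteriori
format) [`FiguerasHaroLuque2016`]; v1 files for everything reused.
-/

noncomputable section

namespace Literature.MathematicalPhysics.QuantumLattice

open Literature.Probability.LatticeModels GrassmannAlgebra Finset Matrix

/-! ### §1 The records -/

/-- **Physical data of the symmetric regime with a field radius** (`π` of request D1′b-v2): the v1
record `SymmetricRegimeData` (frame bound `κ_max`, quartic bound `E₁`, Stoner margin `σ`, field floor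
`ζ`, velocity / curvature bounds, van Hove distance, scale range) EXTENDED by the frame decay exponent
`r` (for the frame regularity norm `Σ_n (1+|n|₁)^r |κ_n|`), the remainder bound `E₃ > 0`, the field
radius `0 < h_r ≤ 1` at which the remainder is weighed (Salmhofer's `h`-weighted norms), and the slope
allowance `c₁ ≥ 0` of the pointwise mismatch clause `|Re Σ| ≤ c₀Λ + c₁|e|`.  A finite decidable object;
nothing about any model is asserted by inhabiting it. [cite: Salmhofer1998, §4.1–4.2 Thm. 1 and §5.3 (h-weighted norms)]
[cite: FiguerasHaroLuque2016, Thm. 2.5 (a-posteriori format)] -/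
structure SymmetricRegimeDataR extends SymmetricRegimeData where
  /-- `r`: decay exponent of the frame regularity norm `Σ_n (1+|n|₁)^r |κ_n|`. -/
  frameDecay : ℕ
  /-- `E₃`: bound on the radius-weighted remainder norm. -/
  remainderBound : ℚ
  /-- `E₃ > 0`. -/
  remainderBound_pos : 0 < remainderBound
  /-- `h_r`: the field radius. -/
  fieldRadius : ℚ
  /-- `0 < h_r`. -/
  fieldRadius_pos : 0 < fieldRadius
  /-- `h_r ≤ 1`. -/
  fieldRadius_le_one : fieldRadius ≤ 1
  /-- `c₁`: slope allowance of the mismatch clause. -/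
  slopeAllowance : ℚ
  /-- `0 ≤ c₁`. -/
  slopeAllowance_nonneg : 0 ≤ slopeAllowance

/-- **Tolerance of a symmetric-regime certificate** (`Θ = (c₀, w)` of request D1′b-v2): the mismatch
constant `c₀ > 0` and the width `w > 0` of the exhibited enclosure of `λ_d`; NO remainder entry (the
remainder is physical data, `SymmetricRegimeDataR.remainderBound`). [cite: FiguerasHaroLuque2016, Thm. 2.5 (a-posteriori format)] -/
structure SymmetricTolerance where
  /-- `c₀`: the Fermi-curve mismatch constant. -/
  mismatch : ℚ
  /-- `0 < c₀`. -/
  mismatch_pos : 0 < mismatch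
  /-- `w`: width of the exhibited rational enclosure `[a, b] ∋ λ_d`. -/
  width : ℚ
  /-- `0 < w`. -/
  width_pos : 0 < width

/-- **The route's literal corner data `π₀`** (request D1′b-v2, item (6); numerals from the planner's
REPAIR_13959.md §1–2: `h_r = 1/4` gives the tree ratio `6 h_r² = 0.375`): frameBound `10`, frameDecay
`4`, quarticBound `4`, remainderBound `32`, fieldRadius `1/4`, slopeAllowance `1/2`, stonerMargin `1/4`,
fieldFloor `1/2`, velLower `1/2`, velUpper `4`, curvLower `1/25`, curvUpper `3`, vanHoveDist `1/2`,
scaleLower `1/100`, scaleUpper `3/10`.  ONE named constant used by producer and consumer; nothing is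
claimed about it. [folklore] -/
def capRgCornerData : SymmetricRegimeDataR where
  frameBound := 10
  quarticBound := 4
  quarticBound_pos := by norm_num
  stonerMargin := 1 / 4
  stonerMargin_pos := by norm_num
  stonerMargin_lt_one := by norm_num
  fieldFloor := 1 / 2
  fieldFloor_pos := by norm_num
  fieldFloor_le_one := by norm_num
  velLower := 1 / 2
  velUpper := 4
  velLower_pos := by norm_num
  velLower_le := by norm_num
  curvLower := 1 / 25
  curvUpper := 3
  curvLower_pos := by norm_num
  curvLower_le := by norm_num
  vanHoveDist := 1 / 2
  vanHoveDist_pos := by norm_num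
  scaleLower := 1 / 100
  scaleUpper := 3 / 10
  scaleLower_pos := by norm_num
  scaleLower_le := by norm_num
  frameDecay := 4
  remainderBound := 32
  remainderBound_pos := by norm_num
  fieldRadius := 1 / 4
  fieldRadius_pos := by norm_num
  fieldRadius_le_one := by norm_num
  slopeAllowance := 1 / 2
  slopeAllowance_nonneg := by norm_num

/-- The corner data's field radius is `1/4`. [folklore] -/
@[simp] theorem capRgCornerData_fieldRadius : capRgCornerData.fieldRadius = 1 / 4 := rfl
/-- The corner data's remainder bound is `32`. [folklore] -/
@[simp] theorem capRgCornerData_remainderBound : capRgCornerData.remainderBound = 32 := rfl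
/-- The corner data's frame decay exponent is `4`. [folklore] -/
@[simp] theorem capRgCornerData_frameDecay : capRgCornerData.frameDecay = 4 := rfl
/-- The corner data's slope allowance is `1/2`. [folklore] -/
@[simp] theorem capRgCornerData_slopeAllowance : capRgCornerData.slopeAllowance = 1 / 2 := rfl
/-- The corner data's frame bound is `10`. [folklore] -/
@[simp] theorem capRgCornerData_frameBound : capRgCornerData.frameBound = 10 := rfl
/-- The corner data's quartic bound is `4`. [folklore] -/
@[simp] theorem capRgCornerData_quarticBound : capRgCornerData.quarticBound = 4 := rfl
/-- The corner data's Stoner margin is `1/4`. [folklore] -/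
@[simp] theorem capRgCornerData_stonerMargin : capRgCornerData.stonerMargin = 1 / 4 := rfl
/-- The corner data's field floor is `1/2`. [folklore] -/
@[simp] theorem capRgCornerData_fieldFloor : capRgCornerData.fieldFloor = 1 / 2 := rfl
/-- The corner data's scale range is `[1/100, 3/10]`. [folklore] -/
theorem capRgCornerData_scale :
    capRgCornerData.scaleLower = 1 / 100 ∧ capRgCornerData.scaleUpper = 3 / 10 := ⟨rfl, rfl⟩
/-- The corner data's shell geometry bounds: `v₁ = 1/2`, `v₂ = 4`, `κ₁ = 1/25`, `κ₂ = 3`, `d_vH = 1/2`.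
[folklore] -/
theorem capRgCornerData_geometry :
    capRgCornerData.velLower = 1 / 2 ∧ capRgCornerData.velUpper = 4 ∧ capRgCornerData.curvLower = 1 / 25 ∧
      capRgCornerData.curvUpper = 3 ∧ capRgCornerData.vanHoveDist = 1 / 2 :=
  ⟨rfl, rfl, rfl, rfl, rfl⟩

/-! ### §2 The radius-weighted remainder -/

section Radius

variable (L M : ℕ) [NeZero L]

/-- **The v1 remainder norm at the rescaled argument `h²Λ` IS the radius-weighted norm**:
`remainderWeightNorm L M β (h² Λ) G = Σ_{m ∉ {0,2,4}} h^{m-4} Λ^{(m-4)/2} ‖𝒱_m‖_∞` (`h ≥ 0`, `Λ ≥ 0`;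
`(h²Λ)^{(m-4)/2} = h^{m-4} Λ^{(m-4)/2}`, `Real.mul_rpow`). [cite: Salmhofer1998, §4.1–4.2 Thm. 1 (h-weighted norms)] -/
theorem remainderWeightNorm_radius {h Λ : ℝ} (hh : 0 ≤ h) (hΛ : 0 ≤ Λ) (β : ℝ) (G : HubbardGrassmann L M) :
    remainderWeightNorm L M β (h ^ 2 * Λ) G =
      ∑ m ∈ (Finset.range (Fintype.card (HubbardFieldIdx L M) + 1)).filter
          (fun m => m ≠ 0 ∧ m ≠ 2 ∧ m ≠ 4),
        h ^ ((m : ℝ) - 4) * Λ ^ (((m : ℝ) - 4) / 2) * vertexSupNorm L M β G m := by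
  unfold remainderWeightNorm
  refine Finset.sum_congr rfl fun m _ => ?_
  rw [Real.mul_rpow (pow_nonneg hh 2) hΛ]
  congr 2
  rw [← Real.rpow_natCast h 2, ← Real.rpow_mul hh]
  congr 1
  push_cast
  ring

end Radius

/-! ### §3 The predicates -/

section Certificate

variable (π : SymmetricRegimeDataR) (Θ : SymmetricTolerance)

/-- **`SymmetricCertifiedAtR π Θ a b Λ L M β e G Z`: the effective action `G` (normaliser `Z`) at
`(L, M, β)` is certified at scale `Λ` against the physical data `π` to tolerance `Θ`, with the pairing
strength in the GIVEN rational interval `[a, b]`, in the frame with renormalised band `e`** — clauses: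
(0a) `Z ≠ 0`; (0b′) pointwise mismatch `|Re Σ((ω₀,k⃗),σ)| ≤ c₀ Λ + c₁ |e(k⃗)|` on the shell; (0c) field
strengths `z(k⃗,σ) ∈ [ζ, 1/ζ]` on the shell; (i′a) `‖𝒱₄‖_∞ ≤ E₁`; (i′b) the remainder at field radius
`h_r`, `remainderWeightNorm L M β (h_r² Λ) G ≤ E₃` (`= Σ_{m∉{0,2,4}} h_r^{m-4} Λ^{(m-4)/2} ‖𝒱_m‖_∞`,
`remainderWeightNorm_radius`); (ii′) Cooper dominance with margin `2` of a `B₁g` bottom and the Stoner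
products `st^c(q⃗), st^s(q⃗) ≤ 1 - σ` at every transfer `q⃗`; (iii′) `a ≤ λ_d ≤ b`.  (A-posteriori
format; posited by route AposterioriCapRg, request D1′b-v2.) [cite: FiguerasHaroLuque2016, Thm. 2.5 (a-posteriori format)]
[cite: Salmhofer1998, §4.2 Thm. 1 (power counting of the remainder)] -/
def SymmetricCertifiedAtR (a b : ℚ) (Λ : ℝ) (L M : ℕ) [NeZero L] [NeZero M] (β : ℝ)
    (e : TorusSite 2 L → ℝ) (G : HubbardGrassmann L M) (Z : ℂ) : Prop :=
  Z ≠ 0 ∧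
  (∀ k ∈ momentumShell L e Λ, ∀ σ : Fin 2,
    |(selfEnergy L M β G (omega0 M, k) σ).re| ≤ Θ.mismatch * Λ + π.slopeAllowance * |e k|) ∧
  (∀ k ∈ momentumShell L e Λ, ∀ σ : Fin 2,
    (π.fieldFloor : ℝ) ≤ fieldStrengthSpin L M β G k σ ∧ fieldStrengthSpin L M β G k σ ≤ 1 / π.fieldFloor) ∧
  vertexSupNorm L M β G 4 ≤ π.quarticBound ∧
  remainderWeightNorm L M β ((π.fieldRadius : ℝ) ^ 2 * Λ) G ≤ π.remainderBound ∧
  (CooperDominance (cooperMatrix L M β e Λ G) ∧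
    ∀ q : TorusSite 2 L, stonerCharge L M β e Λ G q ≤ 1 - π.stonerMargin ∧
      stonerSpin L M β e Λ G q ≤ 1 - π.stonerMargin) ∧
  ((a : ℝ) ≤ pairingStrength L M β e Λ G ∧ pairingStrength L M β e Λ G ≤ b)

/-- **`SymmetricRegimeHoldsR π Θ n eC Λ L₀ e G Z`: the v2 certificate of a MODEL FAMILY** — frame
admissible (`n ≤ κ_max`), `Λ ∈ [Λ₁, Λ₂]`, the continuum shell obeys the geometric bounds of `π`, and
ONE rational enclosure `1/8 ≤ a ≤ b ≤ 1/5`, `b - a ≤ w`, chosen OUTSIDE the thermodynamic block, such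
that for every `L ≥ L₀` there is `β₀` with, for every `β ≥ β₀`, an `M₀` with, for every `M ≥ M₀`,
`SymmetricCertifiedAtR π Θ a b Λ L M β (e L) (G L M β) (Z L M β)`. [cite: FiguerasHaroLuque2016, Thm. 2.5 (a-posteriori format)] -/
def SymmetricRegimeHoldsR (frameNormVal : ℝ) (eC : (Fin 2 → ℝ) → ℝ) (Λ : ℝ) (L₀ : ℕ)
    (e : ∀ (L : ℕ) [NeZero L], TorusSite 2 L → ℝ) (G : ∀ (L M : ℕ) [NeZero L], ℝ → HubbardGrassmann L M)
    (Z : ∀ (L M : ℕ) [NeZero L], ℝ → ℂ) : Prop :=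
  π.AdmitsFrameNorm frameNormVal ∧ π.AdmitsScale Λ ∧
  ShellGeometry eC Λ π.velLower π.velUpper π.curvLower π.curvUpper π.vanHoveDist ∧
  ∃ a b : ℚ, symmetricWindowLower ≤ a ∧ a ≤ b ∧ b ≤ symmetricWindowUpper ∧ b - a ≤ Θ.width ∧
    ∀ L : ℕ, L₀ ≤ L → ∀ [NeZero L], ∃ β₀ : ℝ, ∀ β : ℝ, β₀ ≤ β → ∃ M₀ : ℕ, ∀ M : ℕ, M₀ ≤ M → ∀ [NeZero M],
      SymmetricCertifiedAtR π Θ a b Λ L M β (e L) (G L M β) (Z L M β)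

/-- **`symmetricRegimeCertificateR U μ π Θ K Λ L₀` — the v2 certificate of the countertermed Hubbard
effective action** (request D1′b-v2, item (5)): `SymmetricRegimeHoldsR` for the frame regularity norm
`K.coeffNorm π.frameDecay`, the continuum band `renormalisedBandC μ K`, and the families
`e L = nambuXiCT L μ K`, `G L M β = hubbardEffectiveActionCT L M β U μ 0 K Λ`,
`Z L M β = hubbardEffPartitionFnCT L M β U μ 0 K Λ` — the v1 binding with the v2 predicate.
[cite: FeldmanSalmhoferTrubowitz1996, §1 (the counterterm frame)] [cite: FiguerasHaroLuque2016, Thm. 2.5 (a-posteriori format)] -/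
def symmetricRegimeCertificateR (U μ : ℝ) (π : SymmetricRegimeDataR) (Θ : SymmetricTolerance)
    (K : TrigPolyC4v) (Λ : ℝ) (L₀ : ℕ) : Prop :=
  SymmetricRegimeHoldsR π Θ (K.coeffNorm π.frameDecay) (renormalisedBandC μ K) Λ L₀
    (fun L _ => nambuXiCT L μ K)
    (fun L M _ β => hubbardEffectiveActionCT L M β U μ 0 K Λ)
    (fun L M _ β => hubbardEffPartitionFnCT L M β U μ 0 K Λ)

end Certificate

/-! ### §4 API -/

section API

variable {π : SymmetricRegimeDataR} {Θ : SymmetricTolerance}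

/-- Unfolding `SymmetricCertifiedAtR` into its seven clauses. [folklore] -/
theorem symmetricCertifiedAtR_iff (π : SymmetricRegimeDataR) (Θ : SymmetricTolerance) (a b : ℚ) (Λ : ℝ)
    (L M : ℕ) [NeZero L] [NeZero M] (β : ℝ) (e : TorusSite 2 L → ℝ) (G : HubbardGrassmann L M) (Z : ℂ) :
    SymmetricCertifiedAtR π Θ a b Λ L M β e G Z ↔
      Z ≠ 0 ∧
      (∀ k ∈ momentumShell L e Λ, ∀ σ : Fin 2,
        |(selfEnergy L M β G (omega0 M, k) σ).re| ≤ Θ.mismatch * Λ + π.slopeAllowance * |e k|) ∧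
      (∀ k ∈ momentumShell L e Λ, ∀ σ : Fin 2,
        (π.fieldFloor : ℝ) ≤ fieldStrengthSpin L M β G k σ ∧
          fieldStrengthSpin L M β G k σ ≤ 1 / π.fieldFloor) ∧
      vertexSupNorm L M β G 4 ≤ π.quarticBound ∧
      remainderWeightNorm L M β ((π.fieldRadius : ℝ) ^ 2 * Λ) G ≤ π.remainderBound ∧
      (CooperDominance (cooperMatrix L M β e Λ G) ∧
        ∀ q : TorusSite 2 L, stonerCharge L M β e Λ G q ≤ 1 - π.stonerMargin ∧
          stonerSpin L M β e Λ G q ≤ 1 - π.stonerMargin) ∧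
      ((a : ℝ) ≤ pairingStrength L M β e Λ G ∧ pairingStrength L M β e Λ G ≤ b) :=
  Iff.rfl

section AtR

variable {a b : ℚ} {Λ : ℝ} {L M : ℕ} [NeZero L] [NeZero M] {β : ℝ} {e : TorusSite 2 L → ℝ}
  {G : HubbardGrassmann L M} {Z : ℂ}

/-- Clause (0a): the normaliser is non-zero. [folklore] -/
theorem SymmetricCertifiedAtR.ne_zero (h : SymmetricCertifiedAtR π Θ a b Λ L M β e G Z) : Z ≠ 0 :=
  h.1

/-- Clause (0b′): the pointwise mismatch bound on the shell. [folklore] -/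
theorem SymmetricCertifiedAtR.mismatch_le (h : SymmetricCertifiedAtR π Θ a b Λ L M β e G Z)
    {k : TorusSite 2 L} (hk : k ∈ momentumShell L e Λ) (σ : Fin 2) :
    |(selfEnergy L M β G (omega0 M, k) σ).re| ≤ Θ.mismatch * Λ + π.slopeAllowance * |e k| :=
  h.2.1 k hk σ

/-- Clause (0c): field strengths in `[ζ, 1/ζ]` on the shell. [folklore] -/
theorem SymmetricCertifiedAtR.fieldStrength_mem (h : SymmetricCertifiedAtR π Θ a b Λ L M β e G Z)
    {k : TorusSite 2 L} (hk : k ∈ momentumShell L e Λ) (σ : Fin 2) :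
    (π.fieldFloor : ℝ) ≤ fieldStrengthSpin L M β G k σ ∧ fieldStrengthSpin L M β G k σ ≤ 1 / π.fieldFloor :=
  h.2.2.1 k hk σ

/-- Clause (i′a): `‖𝒱₄‖_∞ ≤ E₁`. [folklore] -/
theorem SymmetricCertifiedAtR.quartic_le (h : SymmetricCertifiedAtR π Θ a b Λ L M β e G Z) :
    vertexSupNorm L M β G 4 ≤ π.quarticBound :=
  h.2.2.2.1

/-- Clause (i′b): the radius-weighted remainder is at most `E₃`. [folklore] -/
theorem SymmetricCertifiedAtR.remainder_le (h : SymmetricCertifiedAtR π Θ a b Λ L M β e G Z) :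
    remainderWeightNorm L M β ((π.fieldRadius : ℝ) ^ 2 * Λ) G ≤ π.remainderBound :=
  h.2.2.2.2.1

/-- Clause (ii′), Cooper part. [folklore] -/
theorem SymmetricCertifiedAtR.cooperDominance (h : SymmetricCertifiedAtR π Θ a b Λ L M β e G Z) :
    CooperDominance (cooperMatrix L M β e Λ G) :=
  h.2.2.2.2.2.1.1

/-- Clause (ii′), Stoner part. [folklore] -/
theorem SymmetricCertifiedAtR.stoner_le (h : SymmetricCertifiedAtR π Θ a b Λ L M β e G Z)
    (q : TorusSite 2 L) :
    stonerCharge L M β e Λ G q ≤ 1 - π.stonerMargin ∧ stonerSpin L M β e Λ G q ≤ 1 - π.stonerMargin :=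
  h.2.2.2.2.2.1.2 q

/-- Clause (iii′): `λ_d ∈ [a, b]`. [folklore] -/
theorem SymmetricCertifiedAtR.window (h : SymmetricCertifiedAtR π Θ a b Λ L M β e G Z) :
    (a : ℝ) ≤ pairingStrength L M β e Λ G ∧ pairingStrength L M β e Λ G ≤ b :=
  h.2.2.2.2.2.2

/-- Shrinking the interval is monotone: a certificate for `[a, b]` is one for any `[a', b'] ⊇ [a, b]`.
[folklore] -/
theorem SymmetricCertifiedAtR.mono_window {a' b' : ℚ} (ha : a' ≤ a) (hb : b ≤ b')
    (h : SymmetricCertifiedAtR π Θ a b Λ L M β e G Z) : SymmetricCertifiedAtR π Θ a' b' Λ L M β e G Z :=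
  ⟨h.1, h.2.1, h.2.2.1, h.2.2.2.1, h.2.2.2.2.1, h.2.2.2.2.2.1,
    (Rat.cast_le.2 ha).trans h.window.1, h.window.2.trans (Rat.cast_le.2 hb)⟩

end AtR

/-- Unfolding `SymmetricRegimeHoldsR`. [folklore] -/
theorem symmetricRegimeHoldsR_iff (π : SymmetricRegimeDataR) (Θ : SymmetricTolerance) (n : ℝ)
    (eC : (Fin 2 → ℝ) → ℝ) (Λ : ℝ) (L₀ : ℕ) (e : ∀ (L : ℕ) [NeZero L], TorusSite 2 L → ℝ)
    (G : ∀ (L M : ℕ) [NeZero L], ℝ → HubbardGrassmann L M) (Z : ∀ (L M : ℕ) [NeZero L], ℝ → ℂ) :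
    SymmetricRegimeHoldsR π Θ n eC Λ L₀ e G Z ↔
      π.AdmitsFrameNorm n ∧ π.AdmitsScale Λ ∧
      ShellGeometry eC Λ π.velLower π.velUpper π.curvLower π.curvUpper π.vanHoveDist ∧
      ∃ a b : ℚ, symmetricWindowLower ≤ a ∧ a ≤ b ∧ b ≤ symmetricWindowUpper ∧ b - a ≤ Θ.width ∧
        ∀ L : ℕ, L₀ ≤ L → ∀ [NeZero L], ∃ β₀ : ℝ, ∀ β : ℝ, β₀ ≤ β → ∃ M₀ : ℕ, ∀ M : ℕ, M₀ ≤ M →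
          ∀ [NeZero M], SymmetricCertifiedAtR π Θ a b Λ L M β (e L) (G L M β) (Z L M β) :=
  Iff.rfl

/-- Unfolding `symmetricRegimeCertificateR`. [folklore] -/
theorem symmetricRegimeCertificateR_iff (U μ : ℝ) (π : SymmetricRegimeDataR) (Θ : SymmetricTolerance)
    (K : TrigPolyC4v) (Λ : ℝ) (L₀ : ℕ) :
    symmetricRegimeCertificateR U μ π Θ K Λ L₀ ↔
      π.AdmitsFrameNorm (K.coeffNorm π.frameDecay) ∧ π.AdmitsScale Λ ∧
      ShellGeometry (renormalisedBandC μ K) Λ π.velLower π.velUpper π.curvLower π.curvUpper π.vanHoveDist ∧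
      ∃ a b : ℚ, symmetricWindowLower ≤ a ∧ a ≤ b ∧ b ≤ symmetricWindowUpper ∧ b - a ≤ Θ.width ∧
        ∀ L : ℕ, L₀ ≤ L → ∀ [NeZero L], ∃ β₀ : ℝ, ∀ β : ℝ, β₀ ≤ β → ∃ M₀ : ℕ, ∀ M : ℕ, M₀ ≤ M →
          ∀ [NeZero M], SymmetricCertifiedAtR π Θ a b Λ L M β (nambuXiCT L μ K)
            (hubbardEffectiveActionCT L M β U μ 0 K Λ) (hubbardEffPartitionFnCT L M β U μ 0 K Λ) :=
  Iff.rfl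

section Holds

variable {n : ℝ} {eC : (Fin 2 → ℝ) → ℝ} {Λ : ℝ} {L₀ : ℕ} {e : ∀ (L : ℕ) [NeZero L], TorusSite 2 L → ℝ}
  {G : ∀ (L M : ℕ) [NeZero L], ℝ → HubbardGrassmann L M} {Z : ∀ (L M : ℕ) [NeZero L], ℝ → ℂ}

/-- A certified frame norm is admissible. [folklore] -/
theorem SymmetricRegimeHoldsR.admitsFrameNorm (h : SymmetricRegimeHoldsR π Θ n eC Λ L₀ e G Z) :
    π.AdmitsFrameNorm n :=
  h.1

/-- A certified scale is admissible. [folklore] -/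
theorem SymmetricRegimeHoldsR.admitsScale (h : SymmetricRegimeHoldsR π Θ n eC Λ L₀ e G Z) :
    π.AdmitsScale Λ :=
  h.2.1

/-- A certified scale is positive. [folklore] -/
theorem SymmetricRegimeHoldsR.scale_pos (h : SymmetricRegimeHoldsR π Θ n eC Λ L₀ e G Z) : 0 < Λ :=
  h.2.1.pos

/-- A certified family has the shell geometry of `π`. [folklore] -/
theorem SymmetricRegimeHoldsR.shellGeometry (h : SymmetricRegimeHoldsR π Θ n eC Λ L₀ e G Z) :
    ShellGeometry eC Λ π.velLower π.velUpper π.curvLower π.curvUpper π.vanHoveDist :=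
  h.2.2.1

/-- Monotonicity in the volume threshold. [folklore] -/
theorem SymmetricRegimeHoldsR.mono {L₀' : ℕ} (hL : L₀ ≤ L₀') (h : SymmetricRegimeHoldsR π Θ n eC Λ L₀ e G Z) :
    SymmetricRegimeHoldsR π Θ n eC Λ L₀' e G Z := by
  obtain ⟨h1, h2, h3, a, b, ha, hab, hb, hw, hblock⟩ := h
  exact ⟨h1, h2, h3, a, b, ha, hab, hb, hw, fun L hL' => hblock L (hL.trans hL')⟩

/-- The exhibited enclosure has positive lower end: `0 < 1/8 ≤ a`. [folklore] -/
theorem SymmetricRegimeHoldsR.exists_window (h : SymmetricRegimeHoldsR π Θ n eC Λ L₀ e G Z) :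
    ∃ a b : ℚ, 0 < a ∧ a ≤ b ∧ b - a ≤ Θ.width ∧
      ∀ L : ℕ, L₀ ≤ L → ∀ [NeZero L], ∃ β₀ : ℝ, ∀ β : ℝ, β₀ ≤ β → ∃ M₀ : ℕ, ∀ M : ℕ, M₀ ≤ M →
        ∀ [NeZero M], SymmetricCertifiedAtR π Θ a b Λ L M β (e L) (G L M β) (Z L M β) := by
  obtain ⟨-, -, -, a, b, ha, hab, -, hw, hblock⟩ := h
  exact ⟨a, b, lt_of_lt_of_le (by norm_num [symmetricWindowLower]) ha, hab, hw, hblock⟩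

end Holds

section Model

variable {U μ : ℝ} {K : TrigPolyC4v} {Λ : ℝ} {L₀ : ℕ}

/-- A certified frame is admissible: `K.coeffNorm r ≤ κ_max`. [folklore] -/
theorem symmetricRegimeCertificateR.coeffNorm_le (h : symmetricRegimeCertificateR U μ π Θ K Λ L₀) :
    K.coeffNorm π.frameDecay ≤ π.frameBound :=
  h.1

/-- A certified scale is admissible. [folklore] -/
theorem symmetricRegimeCertificateR.admitsScale (h : symmetricRegimeCertificateR U μ π Θ K Λ L₀) :
    π.AdmitsScale Λ :=
  h.2.1

/-- A certified scale is positive. [folklore] -/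
theorem symmetricRegimeCertificateR.scale_pos (h : symmetricRegimeCertificateR U μ π Θ K Λ L₀) : 0 < Λ :=
  h.2.1.pos

/-- A certified frame has the shell geometry of `π`. [folklore] -/
theorem symmetricRegimeCertificateR.shellGeometry (h : symmetricRegimeCertificateR U μ π Θ K Λ L₀) :
    ShellGeometry (renormalisedBandC μ K) Λ π.velLower π.velUpper π.curvLower π.curvUpper π.vanHoveDist :=
  h.2.2.1

/-- Monotonicity in the volume threshold. [folklore] -/
theorem symmetricRegimeCertificateR.mono {L₀' : ℕ} (hL : L₀ ≤ L₀')
    (h : symmetricRegimeCertificateR U μ π Θ K Λ L₀) : symmetricRegimeCertificateR U μ π Θ K Λ L₀' :=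
  SymmetricRegimeHoldsR.mono hL h

end Model

end API

/-! ### §5 Junk tests -/

section Junk

variable (π : SymmetricRegimeDataR) (Θ : SymmetricTolerance)

/-- **Junk test: the zero effective action is never certified in an interval with `a > 0`**: its
pairing strength is `λ_d = 0 < a` (`pairingStrength_zero`). [folklore] -/
theorem not_symmetricCertifiedAtR_zero {a : ℚ} (ha : 0 < a) (b : ℚ) (Λ : ℝ) (L M : ℕ) [NeZero L]
    [NeZero M] (β : ℝ) (e : TorusSite 2 L → ℝ) (Z : ℂ) :
    ¬ SymmetricCertifiedAtR π Θ a b Λ L M β e (0 : HubbardGrassmann L M) Z := by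
  intro h
  have hax := h.window.1
  rw [pairingStrength_zero] at hax
  have : (0 : ℝ) < a := by exact_mod_cast ha
  linarith

/-- A model family whose effective action vanishes identically is never in the v2 symmetric regime.
[folklore] -/
theorem not_symmetricRegimeHoldsR_zero (n : ℝ) (eC : (Fin 2 → ℝ) → ℝ) (Λ : ℝ) (L₀ : ℕ)
    (e : ∀ (L : ℕ) [NeZero L], TorusSite 2 L → ℝ) (Z : ∀ (L M : ℕ) [NeZero L], ℝ → ℂ) :
    ¬ SymmetricRegimeHoldsR π Θ n eC Λ L₀ e (fun L M _ _ => (0 : HubbardGrassmann L M)) Z := by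
  intro h
  obtain ⟨a, b, ha, -, -, hblock⟩ := h.exists_window
  haveI : NeZero (L₀ + 1) := ⟨Nat.succ_ne_zero _⟩
  obtain ⟨β₀, hβ₀⟩ := hblock (L₀ + 1) (Nat.le_succ _)
  obtain ⟨M₀, hM₀⟩ := hβ₀ β₀ le_rfl
  haveI : NeZero (M₀ + 1) := ⟨Nat.succ_ne_zero _⟩
  exact not_symmetricCertifiedAtR_zero π Θ ha b Λ (L₀ + 1) (M₀ + 1) β₀ (e (L₀ + 1)) (Z (L₀ + 1) (M₀ + 1) β₀)
    (hM₀ (M₀ + 1) (Nat.le_succ _))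

/-- **Junk test (as requested): the v2 certificate is FALSE at `U = 0` in the bare frame `K = 0`**, for
every chemical potential, data, tolerance, scale and threshold — the free effective action vanishes
(`hubbardEffectiveActionCT_free_zero_frame`), so `λ_d = 0 ∉ [a, b]`, `a ≥ 1/8`. [folklore] -/
theorem not_symmetricRegimeCertificateR_free (μ : ℝ) (Λ : ℝ) (L₀ : ℕ) :
    ¬ symmetricRegimeCertificateR 0 μ π Θ 0 Λ L₀ := by
  intro h
  obtain ⟨a, b, ha, -, -, hblock⟩ := SymmetricRegimeHoldsR.exists_window h
  haveI : NeZero (L₀ + 1) := ⟨Nat.succ_ne_zero _⟩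
  obtain ⟨β₀, hβ₀⟩ := hblock (L₀ + 1) (Nat.le_succ _)
  obtain ⟨M₀, hM₀⟩ := hβ₀ β₀ le_rfl
  haveI : NeZero (M₀ + 1) := ⟨Nat.succ_ne_zero _⟩
  have hc : SymmetricCertifiedAtR π Θ a b Λ (L₀ + 1) (M₀ + 1) β₀ (nambuXiCT (L₀ + 1) μ 0)
      (hubbardEffectiveActionCT (L₀ + 1) (M₀ + 1) β₀ 0 μ 0 0 Λ)
      (hubbardEffPartitionFnCT (L₀ + 1) (M₀ + 1) β₀ 0 μ 0 0 Λ) := hM₀ (M₀ + 1) (Nat.le_succ _)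
  rw [hubbardEffectiveActionCT_free_zero_frame] at hc
  exact not_symmetricCertifiedAtR_zero π Θ ha b Λ (L₀ + 1) (M₀ + 1) β₀ _ _ hc

end Junk

end Literature.MathematicalPhysics.QuantumLattice

end
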